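import Summits.Ventures.LatticeQCDFlow.Exactness.AcceptanceFromMeanEnergyViolationSharp
import Summits.Ventures.LatticeQCDFlow.Exactness.FlowSamplerSwapInvolution
import Mathlib.Analysis.SpecialFunctions.Trigonometric.DerivHyp
import HarnessLib

/-!
HONEST FRAMING: exact (Metropolis-corrected) sampling algorithms for lattice gauge theory; figures
of merit are autocorrelation/cost numbers at stated couplings and volumes; no continuum-physics
claim.

# FlowSamplerJeffreysSharpFloor — THE SHARP JEFFREYS FLOOR OF THE EXACT FLOW SAMPLER:
# `ā ≥ 1 − (cosh a − 1 + J(π, q̃))/(a + sinh a)` FOR EVERY `a > 0`, ENVELOPE `ā ≥ 1 − tanh(a⋆/2) = 2/(1 + e^{a⋆})`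
# AT `a⋆ tanh(a⋆/2) = J`; STIFF MEMBER `ā ≥ (1 − e^{−J})/(J + sinh J)` (row 22 `su3-ptbc`, GEN-10, ours; sequel of
# row 2's `FlowSamplerSwapInvolution` / `FlowSamplerJeffreysPinskerFloor` with this seat's
# `AcceptanceFromMeanEnergyViolationSharp`)

Venture `LatticeQCDFlow` (cell pub-lqcd), topic `Exactness`; FANOUT row 22 (`su3-ptbc`; the PTBC swap and the flow
sampler's independence step are the SAME involution — lean-2's `swapAcc_eq_imh`).  NEW WORK of the cell: the
composition of row 2's dictionary `FlowSamplerSwapInvolution` (the exact flow sampler's Metropolis step with target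
weight `w` and flow density `q̃` is the swap involution on `(X × X, μ ⊗ μ)` with `e^{−H} = w(x)q̃(y)`,
`min(1, e^{−ΔH}) = imhAcceptQ w q̃ x y`, `Z = ∫ w`, `⟨ΔH⟩ = J(π, q̃) = D(π‖q̃) + D(q̃‖π)`, the Jeffreys divergence)
with this seat's extremal floor for involutions `involutive_acceptance_ge_cosh`.  Nothing is cited as a fact; no
definition; no numerics.

THE POINT.  Row 2 floored the equilibrium acceptance `ā` of every exact flow sampler by its two relative
entropies through `J`: Bretagnolle–Huber `ā ≥ 1 − √(1 − e^{−J})` (`imh_meanAccept_ge_jeffreys`) and Pinsker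
`ā ≥ 1 − √(J/2)` (`imh_meanAccept_ge_jeffreys_pinsker`).  The extremal floor of
`AcceptanceFromMeanEnergyViolationSharp` replaces both by the best possible statement in terms of `J` alone:

  `ā ≥ 1 − (cosh a − 1 + J)/(a + sinh a)`  for every `a > 0`,

whose envelope `1 − tanh(a⋆/2)` (`a⋆ tanh(a⋆/2) = J`) is attained by a two-point target/flow pair
(`AcceptanceFromMeanEnergyViolationTwoState`), dominates Pinsker (member `a = √(2J)`) and Bretagnolle–Huber, and
in the badly-trained regime decays like `2e^{−J}` (member `a = J`: `ā ≥ (1 − e^{−J})/(J + sinh J)`) instead of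
Bretagnolle–Huber's `½e^{−J}`.  Direction of use: a flow CERTIFIED to have Jeffreys divergence `J` is CERTIFIED to
accept at least `1 − tanh(a⋆/2)` in equilibrium, and no better certificate from `J` alone exists; the converse
inference (low acceptance ⇒ large `J`) is valid, but large `J` does NOT force low acceptance (three-state witness,
`AcceptanceFromMeanEnergyViolationNoCeiling`).

## What is proved (general `(X, μ)`, `μ` s-finite; `w, q̃ > 0` measurable integrable, `∫ q̃ = 1`,
`w log b, q̃ log b ∈ L¹`, `b = w/q̃`, `J = (∫ w log b)/Z − ∫ q̃ log b`, `Z = ∫ w`)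

* **`imh_meanAccept_ge_jeffreys_cosh`** — for every `a > 0`:
  `(1 − (cosh a − 1 + J)/(a + sinh a))·Z ≤ ∫ w(x)(∫ imhAcceptQ w q̃ x y · q̃(y))`;
* **`imh_meanAccept_ge_jeffreys_stiff`** — `J > 0 ⇒ ((1 − e^{−J})/(J + sinh J))·Z ≤ ∫ w(x)(∫ imhAcceptQ w q̃ x y · q̃(y))`;
* **`jeffreys_ge_of_imh_meanAccept_le`** — the converse reading: acceptance `≤ α·Z` (`0 < α < 1`) ⇒
  `J ≥ (1 − α)·log((2 − α)/α)` — a measured acceptance certifies a lower bound on the flow's Jeffreys divergence;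
* lattice φ⁴ (`λ > 0`, real couplings, any positive flow density with the two log-moments finite):
  **`phi4Flow_meanAccept_ge_jeffreys_cosh`**.

Literature grade (cell rule): KNOWN MECHANISM (acceptance of neural IMH controlled by divergences between target
and flow: Albergo–Kanwar–Shanahan 2019, Nicoli et al. 2020 discuss `ā` vs training loss qualitatively), NEW
TYPING (the sharp constant).  NOT CLAIMED: any value of `J` or `ā` for any network; an upper bound on `ā` from `J`.
-/

namespace Summit.Ventures.LatticeQCDFlow.Exactness

open Real MeasureTheory Filter Set
open Summit.Ventures.LatticeQCDFlow.Scoring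

section General

variable {X : Type*} [MeasurableSpace X] {μ : Measure X} [SFinite μ] {w q : X → ℝ}

/-- **THE SHARP JEFFREYS FLOOR OF THE EXACT FLOW SAMPLER**: `w, q̃ > 0` measurable integrable, `∫ q̃ = 1`,
`w log b, q̃ log b ∈ L¹`; with `J = (∫ w log b)/Z − ∫ q̃ log b` and every `a > 0`:
`(1 − (cosh a − 1 + J)/(a + sinh a))·Z ≤ ∫ w(x)(∫ imhAcceptQ w q̃ x y · q̃(y))`. [ours] -/
theorem imh_meanAccept_ge_jeffreys_cosh (hw0 : ∀ t, 0 < w t) (hwm : Measurable w)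
    (hwi : Integrable w μ) (hq0 : ∀ t, 0 < q t) (hqm : Measurable q) (hqi : Integrable q μ)
    (hq1 : ∫ z, q z ∂μ = 1) (hwl : Integrable (fun t => Real.log (w t / q t) * w t) μ)
    (hql : Integrable (fun t => Real.log (w t / q t) * q t) μ) {a : ℝ} (ha : 0 < a) :
    (1 - (Real.cosh a - 1 + ((∫ t, Real.log (w t / q t) * w t ∂μ) / (∫ z, w z ∂μ)
        - ∫ t, Real.log (w t / q t) * q t ∂μ)) / (a + Real.sinh a)) * ∫ z, w z ∂μ
      ≤ ∫ x, w x * (∫ y, imhAcceptQ w q x y * q y ∂μ) ∂μ := by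
  set H : X × X → ℝ := fun z => -Real.log (w z.1) - Real.log (q z.2) with hH
  have hHm : Measurable H :=
    ((Real.measurable_log.comp (hwm.comp measurable_fst)).neg).sub
      (Real.measurable_log.comp (hqm.comp measurable_snd))
  have hΨμ : MeasurePreserving (Prod.swap : X × X → X × X) (μ.prod μ) (μ.prod μ) :=
    Measure.measurePreserving_swap
  have hΨi : Function.Involutive (Prod.swap : X × X → X × X) := fun p => Prod.swap_swap p
  have hZ : 0 < ∫ z, w z ∂μ := integral_pos_of_pos hw0 hwi hq1
  have hexp : Integrable (fun z => Real.exp (-H z)) (μ.prod μ) := by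
    have h : Integrable (fun p : X × X => w p.1 * q p.2) (μ.prod μ) := hwi.mul_prod hqi
    exact h.congr (Eventually.of_forall fun p => (swapEnergy_exp_neg hw0 hq0 p).symm)
  have hZH : ∫ z, Real.exp (-H z) ∂(μ.prod μ) = ∫ z, w z ∂μ := integral_exp_neg_swapEnergy hw0 hq0 hq1
  obtain ⟨hΔi, hΔ⟩ := integral_deltaH_swapEnergy hw0 hwi hq0 hqi hq1 hwl hql
  have key := involutive_acceptance_ge_cosh (μ := μ.prod μ) hHm measurable_swap hΨi hΨμ hexp hΔi
    (by rw [hZH]; exact hZ) ha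
  rw [hZH, hΔ] at key
  have hacc : ∫ z, min 1 (Real.exp (-deltaH H Prod.swap z)) * Real.exp (-H z) ∂(μ.prod μ)
      = ∫ x, w x * (∫ y, imhAcceptQ w q x y * q y ∂μ) ∂μ := by
    have e : (fun z : X × X => min 1 (Real.exp (-deltaH H Prod.swap z)) * Real.exp (-H z))
        = fun z => w z.1 * (imhAcceptQ w q z.1 z.2 * q z.2) := by
      funext z
      rw [imhAcceptQ_eq_min_exp_neg_deltaH hw0 hq0 z, swapEnergy_exp_neg hw0 hq0 z]
      ring
    rw [e]
    have hint : Integrable (fun z : X × X => w z.1 * (imhAcceptQ w q z.1 z.2 * q z.2)) (μ.prod μ) := by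
      refine (hwi.mul_prod hqi).mono' ?_ (Eventually.of_forall fun z => ?_)
      · exact ((hwm.comp measurable_fst).mul
          ((measurable_imhAcceptQ hwm hqm).mul (hqm.comp measurable_snd))).aestronglyMeasurable
      · have ha0 := imhAcceptQ_nonneg hw0 hq0 z.1 z.2
        have ha1 := imhAcceptQ_le_one w q z.1 z.2
        rw [Real.norm_eq_abs, abs_of_nonneg (mul_nonneg (hw0 _).le (mul_nonneg ha0 (hq0 _).le))]
        have := mul_le_of_le_one_left (hq0 z.2).le ha1
        exact mul_le_mul_of_nonneg_left this (hw0 _).le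
    rw [integral_prod _ hint]
    exact integral_congr_ae (Eventually.of_forall fun x => by
      dsimp only
      rw [integral_const_mul])
  rw [hacc] at key
  have e2 : (∫ t, Real.log (w t / q t) * w t ∂μ - (∫ z, w z ∂μ) * ∫ t, Real.log (w t / q t) * q t ∂μ)
      / ∫ z, w z ∂μ
      = (∫ t, Real.log (w t / q t) * w t ∂μ) / (∫ z, w z ∂μ) - ∫ t, Real.log (w t / q t) * q t ∂μ := by
    field_simp
  rw [e2] at key
  exact key

/-- **THE STIFF MEMBER** (`a = J`): if `J > 0` then `((1 − e^{−J})/(J + sinh J))·Z ≤ ∫ w(x)(∫ imhAcceptQ w q̃ x y · q̃(y))`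
— in the badly-trained regime the certified acceptance decays like `2e^{−J}`, four times the Bretagnolle–Huber
certificate. [ours] -/
theorem imh_meanAccept_ge_jeffreys_stiff (hw0 : ∀ t, 0 < w t) (hwm : Measurable w)
    (hwi : Integrable w μ) (hq0 : ∀ t, 0 < q t) (hqm : Measurable q) (hqi : Integrable q μ)
    (hq1 : ∫ z, q z ∂μ = 1) (hwl : Integrable (fun t => Real.log (w t / q t) * w t) μ)
    (hql : Integrable (fun t => Real.log (w t / q t) * q t) μ)
    (hJ : 0 < (∫ t, Real.log (w t / q t) * w t ∂μ) / (∫ z, w z ∂μ) - ∫ t, Real.log (w t / q t) * q t ∂μ) :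
    ((1 - Real.exp (-((∫ t, Real.log (w t / q t) * w t ∂μ) / (∫ z, w z ∂μ)
        - ∫ t, Real.log (w t / q t) * q t ∂μ)))
        / (((∫ t, Real.log (w t / q t) * w t ∂μ) / (∫ z, w z ∂μ) - ∫ t, Real.log (w t / q t) * q t ∂μ)
          + Real.sinh ((∫ t, Real.log (w t / q t) * w t ∂μ) / (∫ z, w z ∂μ)
            - ∫ t, Real.log (w t / q t) * q t ∂μ))) * ∫ z, w z ∂μ
      ≤ ∫ x, w x * (∫ y, imhAcceptQ w q x y * q y ∂μ) ∂μ := by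
  set J := (∫ t, Real.log (w t / q t) * w t ∂μ) / (∫ z, w z ∂μ) - ∫ t, Real.log (w t / q t) * q t ∂μ
    with hJdef
  have h := imh_meanAccept_ge_jeffreys_cosh hw0 hwm hwi hq0 hqm hqi hq1 hwl hql hJ
  have hc : 0 < J + Real.sinh J := add_pos hJ (Real.sinh_pos_iff.mpr hJ)
  have e : 1 - (Real.cosh J - 1 + J) / (J + Real.sinh J) = (1 - Real.exp (-J)) / (J + Real.sinh J) := by
    rw [← Real.cosh_sub_sinh J]
    field_simp
    ring
  rw [← e]
  exact h

/-- **THE CONVERSE READING — A LOW ACCEPTANCE CERTIFIES A LARGE JEFFREYS DIVERGENCE**: under the same hypotheses,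
if the equilibrium acceptance is at most `α ∈ (0,1)` (`∫ w(x)(∫ imhAcceptQ w q̃ x y·q̃(y)) ≤ α·Z`) then
`J(π, q̃) ≥ (1 − α)·log((2 − α)/α)` (the pencil member with `tanh(a/2) = 1 − α`; e.g. `α = 1/2 ⇒ J ≥ ½ log 3`).
[ours] -/
theorem jeffreys_ge_of_imh_meanAccept_le (hw0 : ∀ t, 0 < w t) (hwm : Measurable w)
    (hwi : Integrable w μ) (hq0 : ∀ t, 0 < q t) (hqm : Measurable q) (hqi : Integrable q μ)
    (hq1 : ∫ z, q z ∂μ = 1) (hwl : Integrable (fun t => Real.log (w t / q t) * w t) μ)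
    (hql : Integrable (fun t => Real.log (w t / q t) * q t) μ) {α : ℝ} (hα0 : 0 < α) (hα1 : α < 1)
    (hacc : ∫ x, w x * (∫ y, imhAcceptQ w q x y * q y ∂μ) ∂μ ≤ α * ∫ z, w z ∂μ) :
    (1 - α) * Real.log ((2 - α) / α)
      ≤ (∫ t, Real.log (w t / q t) * w t ∂μ) / (∫ z, w z ∂μ) - ∫ t, Real.log (w t / q t) * q t ∂μ := by
  set J := (∫ t, Real.log (w t / q t) * w t ∂μ) / (∫ z, w z ∂μ) - ∫ t, Real.log (w t / q t) * q t ∂μ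
    with hJdef
  set a := Real.log ((2 - α) / α) with ha_def
  have hu : 0 < (2 - α) / α := div_pos (by linarith) hα0
  have hu1 : 1 < (2 - α) / α := by rw [lt_div_iff₀ hα0]; linarith
  have ha : 0 < a := Real.log_pos hu1
  have hc : 0 < a + Real.sinh a := add_pos ha (Real.sinh_pos_iff.mpr ha)
  have hZ : 0 < ∫ z, w z ∂μ := integral_pos_of_pos hw0 hwi hq1
  have h := imh_meanAccept_ge_jeffreys_cosh hw0 hwm hwi hq0 hqm hqi hq1 hwl hql ha
  -- `(1 − (cosh a − 1 + J)/(a + sinh a))·Z ≤ acceptance ≤ α·Z`, so `1 − α ≤ (cosh a − 1 + J)/(a + sinh a)`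
  have h1 : (1 - (Real.cosh a - 1 + J) / (a + Real.sinh a)) * ∫ z, w z ∂μ ≤ α * ∫ z, w z ∂μ := h.trans hacc
  have h2 : 1 - (Real.cosh a - 1 + J) / (a + Real.sinh a) ≤ α := le_of_mul_le_mul_right h1 hZ
  have h3 : 1 - α ≤ (Real.cosh a - 1 + J) / (a + Real.sinh a) := by linarith
  rw [le_div_iff₀ hc] at h3
  -- the member identity `cosh a − 1 = (1 − α) sinh a` at `e^{a} = (2 − α)/α`
  have hid : Real.cosh a - 1 = (1 - α) * Real.sinh a := by
    rw [Real.cosh_eq, Real.sinh_eq, Real.exp_neg, ha_def, Real.exp_log hu]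
    have hα : α ≠ 0 := hα0.ne'
    have h2' : (2 - α) ≠ 0 := by intro h; linarith
    field_simp
    ring
  nlinarith [h3, hid]

end General

section Lattice

variable {n : ℕ}

/-- **Lattice φ⁴**: `λ > 0`, real `J`, any positive measurable flow density `q̃` with `∫ q̃ = 1` and
`e^{−S} log b, q̃ log b ∈ L¹`: with `Jf = ⟨log b⟩_S − ∫ q̃ log b` and every `a > 0`,
`(1 − (cosh a − 1 + Jf)/(a + sinh a))·Z ≤ ∫ e^{−S}(∫ imhAcceptQ e^{−S} q̃ φ φ'·q̃(φ'))`. [ours] -/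
theorem phi4Flow_meanAccept_ge_jeffreys_cosh {lam : ℝ} (hlam : 0 < lam)
    (J : Fin (n + 1) → Fin (n + 1) → ℝ) {q : (Fin (n + 1) → ℝ) → ℝ} (hq0 : ∀ φ, 0 < q φ)
    (hqm : Measurable q) (hqi : Integrable q) (hq1 : ∫ φ, q φ = 1)
    (hwl : Integrable (fun φ => Real.log (gibbsWeight J lam φ / q φ) * gibbsWeight J lam φ))
    (hql : Integrable (fun φ => Real.log (gibbsWeight J lam φ / q φ) * q φ)) {a : ℝ} (ha : 0 < a) :
    (1 - (Real.cosh a - 1 + (gibbsExpect J lam (fun φ => Real.log (gibbsWeight J lam φ / q φ))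
        - ∫ φ, Real.log (gibbsWeight J lam φ / q φ) * q φ)) / (a + Real.sinh a)) * gibbsZ J lam
      ≤ ∫ φ, gibbsWeight J lam φ * (∫ φ', imhAcceptQ (gibbsWeight J lam) q φ φ' * q φ') := by
  have h := imh_meanAccept_ge_jeffreys_cosh (μ := volume) (fun φ => gibbsWeight_pos J lam φ)
    (continuous_gibbsWeight J lam).measurable (integrable_gibbsWeight hlam J) hq0 hqm hqi hq1 hwl hql ha
  unfold gibbsExpect
  exact h

end Lattice

end Summit.Ventures.LatticeQCDFlow.Exactness
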